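import Literature.NumberTheory.Sieve.SieveProductsSingularSeries
import Literature.NumberTheory.LFunctions.QuadraticCharacterShiftSums
import HarnessLib

/-!
# Matomäki–Merikoski §7, main terms: the product of local factors `V₁ V₂ · U · Π²` is `𝔖_h (1 + O(1/z))`

Sibling of the `SiegelZeroPrimePairsMainTerm*` files.  Everything here is PROVED (theorems only).  In the main
term of Proposition 2.3 the local factors appear as
`V₁ = ∏_{p<z, p∣h, p∤q} (1 − 1/p)`, `V₂ = ∏_{p<z, p∤hq} (1 − 2/p)` and, for `Σ̃_{S,S}` (`ψ₁ = ψ₂ = χ₀`),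
`U = (1/φ*(q)) ∑_{γ (q)} χ₀(γ)χ₀(γ+h) = ∏_{p∣(q,h)}(1 − 1/p) ∏_{p∣q, p∤h}(1 − 2/p)` (Lemma 2.5 (8)); after
Lemma 2.4 twice one has the factor `Π² = ∏_{p<z}(1 − 1/p)^{−2}`, and (7.3) turns `V₁V₂ U Π²` into
`𝔖_h (1 + O(u/z))`.  This file glues the three tree results together:

* `MatomakiMerikoski.localFactors_mul_eq` — `V₁ · V₂ = ∏_{p<z, p∤q} (if p ∣ h then 1 − 1/p else 1 − 2/p)`;
* `MatomakiMerikoski.re_trivialShiftSum_eq` — the real part of `(1/q)∑_{m (q)} χ₀(m)χ₀(m+h)` equals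
  `∏_{p∣q} (if p ∣ h then 1 − 1/p else 1 − 2/p)` (from `MatomakiMerikoski2023_lemma25_one_one`);
* `MatomakiMerikoski.abs_localFactors_mul_sub_singularSeries_le` — for even `h ≠ 0`, `z ≥ 4`,
  `2·#{p ∣ h : p ≥ z} ≤ z`:
  `|V₁ V₂ · U · Π² − 𝔖_h| ≤ 𝔖_h (2 + 2#{p ∣ q : p ≥ z} + 4#{p ∣ h : p ≥ z})/z`
  (from `SieveProductsSingularSeries.abs_sieveProducts_sub_goldbachSingularSeries_le`, (7.3)).

## References

* K. Matomäki, J. Merikoski, IMRN 2023:23, 20337–20384 (arXiv:2112.11412), Lemma 2.5 (8) and §7 (7.3).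
  [cite: MatomakiMerikoski2023, Lemma 2.5 (8), §7 (7.3)]
-/

noncomputable section

open Finset

namespace Literature.Barriers.Parity.MatomakiMerikoski

open Literature.NumberTheory.Sieve
open Literature.NumberTheory.LFunctions

/-- `V₁ V₂ = ∏_{p<z, p∤q} (if p ∣ h then 1 − 1/p else 1 − 2/p)` (splitting the primes `p ∤ q` below `z`
according to `p ∣ h`; for a prime `p ∤ q`, `p ∤ hq ↔ p ∤ h`). [folklore] -/
theorem localFactors_mul_eq (h q : ℕ) (z : ℝ) :
    (∏ p ∈ (Nat.primesBelow ⌈z⌉₊).filter (fun p => p ∣ h ∧ ¬ p ∣ q), (1 - 1 / (p : ℝ))) *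
      (∏ p ∈ (Nat.primesBelow ⌈z⌉₊).filter (fun p => ¬ p ∣ h * q), (1 - 2 / (p : ℝ))) =
    ∏ p ∈ (Nat.primesBelow ⌈z⌉₊).filter (fun p => ¬ p ∣ q),
      (if p ∣ h then 1 - 1 / (p : ℝ) else 1 - 2 / (p : ℝ)) := by
  rw [prod_ite, filter_filter, filter_filter]
  congr 1
  · refine prod_congr ?_ fun _ _ => rfl
    ext p; simp only [mem_filter]; tauto
  · refine prod_congr ?_ fun _ _ => rfl
    ext p
    simp only [mem_filter, Nat.mem_primesBelow]
    constructor
    · rintro ⟨hp, hpq⟩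
      exact ⟨hp, fun hq => hpq (dvd_mul_of_dvd_right hq h), fun hh => hpq (dvd_mul_of_dvd_left hh q)⟩
    · rintro ⟨hp, hpq, hph⟩
      refine ⟨hp, fun hhq => ?_⟩
      rcases (Nat.Prime.dvd_mul hp.2).mp hhq with h1 | h1
      · exact hph h1
      · exact hpq h1

/-- **Lemma 2.5 (8), real form**: for a modulus `q` carrying a primitive quadratic character and even `h`,
`Re((1/q) ∑_{m (q)} χ₀(m) χ₀(m+h)) = ∏_{p∣q} (if p ∣ h then 1 − 1/p else 1 − 2/p)`.
[cite: MatomakiMerikoski2023, Lemma 2.5 (8)] -/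
theorem re_trivialShiftSum_eq {q : ℕ} [NeZero q] {χ : DirichletCharacter ℂ q} (hprim : χ.IsPrimitive)
    (hquad : χ.IsQuadratic) {h : ℕ} (hh : Even h) :
    ((1 / (q : ℂ)) * ∑ m : ZMod q, (1 : DirichletCharacter ℂ q) m *
        (1 : DirichletCharacter ℂ q) (m + h)).re =
      ∏ p ∈ q.primeFactors, (if p ∣ h then 1 - 1 / (p : ℝ) else 1 - 2 / (p : ℝ)) := by
  have key := MatomakiMerikoski2023_lemma25_one_one χ hprim hquad (s := 1) (Or.inl rfl) hh
  simp only [Int.cast_one, one_mul] at key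
  rw [key, prod_ite]
  have e1 : (∏ p ∈ q.primeFactors.filter (· ∣ h), (1 - 1 / (p : ℂ))) =
      ((∏ p ∈ q.primeFactors.filter (· ∣ h), (1 - 1 / (p : ℝ)) : ℝ) : ℂ) := by
    push_cast; rfl
  have e2 : (∏ p ∈ q.primeFactors.filter (fun p => ¬ p ∣ h), (1 - 2 / (p : ℂ))) =
      ((∏ p ∈ q.primeFactors.filter (fun p => ¬ p ∣ h), (1 - 2 / (p : ℝ)) : ℝ) : ℂ) := by
    push_cast; rfl
  rw [e1, e2, ← Complex.ofReal_mul, Complex.ofReal_re]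

/-- **The local factors of the main term of `Σ̃_{S,S}` give the singular series** (Matomäki–Merikoski
Lemma 2.5 (8) with (7.3)): for even `h ≠ 0`, a modulus `q` carrying a primitive quadratic character, `z ≥ 4`
and `2·#{p ∣ h : p ≥ z} ≤ z`,
`|V₁ V₂ · Re((1/q)∑_{m (q)} χ₀(m)χ₀(m+h)) · (∏_{p<z}(1 − 1/p))^{−2} − 𝔖_h|
  ≤ 𝔖_h (2 + 2#{p ∣ q : p ≥ z} + 4#{p ∣ h : p ≥ z})/z`.
[cite: MatomakiMerikoski2023, Lemma 2.5 (8), §7 (7.3)] -/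
theorem abs_localFactors_mul_sub_singularSeries_le {q : ℕ} [NeZero q] {χ : DirichletCharacter ℂ q}
    (hprim : χ.IsPrimitive) (hquad : χ.IsQuadratic) {h : ℕ} (hh : Even h) (hh0 : h ≠ 0) {z : ℝ}
    (hz : 4 ≤ z) (hkh : 2 * (#(h.primeFactors.filter (fun p : ℕ => z ≤ (p : ℝ))) : ℝ) ≤ z) :
    |(∏ p ∈ (Nat.primesBelow ⌈z⌉₊).filter (fun p => p ∣ h ∧ ¬ p ∣ q), (1 - 1 / (p : ℝ))) *
        (∏ p ∈ (Nat.primesBelow ⌈z⌉₊).filter (fun p => ¬ p ∣ h * q), (1 - 2 / (p : ℝ))) *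
        ((1 / (q : ℂ)) * ∑ m : ZMod q, (1 : DirichletCharacter ℂ q) m *
          (1 : DirichletCharacter ℂ q) (m + h)).re *
        ((∏ p ∈ Nat.primesBelow ⌈z⌉₊, (1 - (p : ℝ)⁻¹))⁻¹) ^ 2 - goldbachSingularSeries h| ≤
      goldbachSingularSeries h *
        ((2 + 2 * #(q.primeFactors.filter (fun p : ℕ => z ≤ (p : ℝ))) +
          4 * #(h.primeFactors.filter (fun p : ℕ => z ≤ (p : ℝ)))) / z) := by
  rw [localFactors_mul_eq, re_trivialShiftSum_eq hprim hquad hh]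
  exact SieveProductsSingularSeries.abs_sieveProducts_sub_goldbachSingularSeries_le hh hh0 (NeZero.ne q) hz
    hkh

end Literature.Barriers.Parity.MatomakiMerikoski
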